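import Summits.AtomisticToContinuum.Crystallization.Theorems.FreeSplittingCertificatesRadiusLadderPeriodicHcp

/-!
# Free splitting certificates — radius ladder: fcc fragments never refute (by name)

Companion of `FreeSplittingCertificatesRadiusLadderPeriodicHcp`: the second LP-binding family of the R = 2 zoo of
the FreeSplitting recurrent-pattern LP (RESULTS-R2 §0: `fcc_ball_r6`, solo value `-0.709006`) is retired
BY NAME.

* `fcc_barlowPos_add`, `fcc_barlowPos_neg`, `fccStacking_add_mem_iff`: the fcc sites `barlowPos a h constHagg k i j`
  form an additive subgroup (fcc is a Bravais lattice; the tree records it with a one-point motif,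
  `fccPeriodicConfiguration`), hence `fcc_homogeneous`: every site is a translation centre of the point set.
* `fcc_norm_sq_eq`: `‖(k,i,j)‖² = a² (i² + ij + j² + k (i + j) + k²/3) + k² h²`;
  `fcc_min_le_norm_sq`: every non-zero site has squared norm `≥ min (min a² (9h²)) (a²/3 + h²)` (in-layer
  neighbours `a²`, adjacent-layer neighbours `a²/3 + h²`, the site three layers up `9h²`; integer lemma:
  `3 ∤ k ⇒ 3 (i² + ij + j² + k(i+j)) + k² ≥ 1`, and for `k = 3m` the lateral form is
  `(i+m)² + (i+m)(j+m) + (j+m)²`).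
* `attractive_fcc`, `halfRule_feasibleOn_fcc`, `halfRule_feasibleOn_fcc_ideal` (`h² = 2a²/3`, only `a⁶ ≥ 1/2`):
  the half rule is feasible at every site of every finite injective fragment of fcc, at every look radius `R`.
* `not_refuting_of_closePacked_fragments`: a zoo each of whose members is an injective fragment of an ideal hcp
  or an ideal fcc stacking with `a⁶ ≥ 1/2` (the spacing may differ per member) is never refuting — the Barlow-ball
  part of the lane's union-66 zoo (hcp/fcc balls at `a* = 0.9712`, `(0.9712)⁶ ≥ 1/2`) by name.

VALUE = theorems about the finite LP falsifier of crux `FiniteRangeSplitting` (item 12559); NOT summit progress and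
no bearing on the truth of the crux.
-/

namespace Summit.AtomisticToContinuum.Crystallization.Theorems.StrictSplittingRuleBirth

open scoped BigOperators Classical
open Literature.MathematicalPhysics.StatisticalMechanics

section Fcc

variable {a h : ℝ}

variable (a h) in
/-- The origin is the fcc site `(0,0,0)`. [folklore] -/
theorem fcc_barlowPos_zero : barlowPos a h constHagg 0 0 0 = 0 := by
  simp [barlowPos]

variable (a h) in
/-- **fcc sites add**: `barlowPos` of the constant Hägg sequence is additive in `(k, i, j)` (the letter of layer
`k` is `k`). [folklore] -/
theorem fcc_barlowPos_add (k i j k' i' j' : ℤ) :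
    barlowPos a h constHagg k i j + barlowPos a h constHagg k' i' j' =
      barlowPos a h constHagg (k + k') (i + i') (j + j') := by
  simp only [barlowPos, haggLabel_const, Int.cast_add, add_smul]
  abel

variable (a h) in
/-- Negation of an fcc site. [folklore] -/
theorem fcc_barlowPos_neg (k i j : ℤ) :
    -barlowPos a h constHagg k i j = barlowPos a h constHagg (-k) (-i) (-j) := by
  rw [neg_eq_iff_add_eq_zero, fcc_barlowPos_add]
  simpa using fcc_barlowPos_zero a h

/-- **fcc is a subgroup**: translating by a site preserves the point set. [folklore] -/
theorem fccStacking_add_mem_iff {p₀ : EuclideanSpace ℝ (Fin 3)} (hp₀ : p₀ ∈ fccStacking a h)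
    (q : EuclideanSpace ℝ (Fin 3)) : q ∈ fccStacking a h ↔ p₀ + q ∈ fccStacking a h := by
  obtain ⟨k, i, j, rfl⟩ := hp₀
  constructor
  · rintro ⟨k', i', j', rfl⟩
    exact ⟨k + k', i + i', j + j', fcc_barlowPos_add a h k i j k' i' j'⟩
  · rintro ⟨k', i', j', hk⟩
    refine ⟨-k + k', -i + i', -j + j', ?_⟩
    rw [← fcc_barlowPos_add, ← fcc_barlowPos_neg, ← hk, neg_add_cancel_left]

/-- **fcc is site-homogeneous by translations** (the hypothesis of `attractive_of_homogeneous` /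
`latticeSiteSum_hom_of_homogeneous`, with `B = 1`). -/
theorem fcc_homogeneous (ha : a ≠ 0) (hh : h ≠ 0) :
    ∀ p₀ ∈ (fccPeriodicConfiguration ha hh).points,
      ∃ B : EuclideanSpace ℝ (Fin 3) ≃ₗᵢ[ℝ] EuclideanSpace ℝ (Fin 3),
        ∀ q, q ∈ (fccPeriodicConfiguration ha hh).points ↔
          p₀ + B q ∈ (fccPeriodicConfiguration ha hh).points := by
  intro p₀ hp₀
  rw [fccPeriodicConfiguration_points] at hp₀
  refine ⟨LinearIsometryEquiv.refl ℝ _, fun q => ?_⟩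
  rw [fccPeriodicConfiguration_points]
  exact fccStacking_add_mem_iff hp₀ q

variable (a h) in
/-- **Squared norm of an fcc site**: `‖(k,i,j)‖² = a² (i² + ij + j² + k (i + j) + k²/3) + k² h²`. [folklore] -/
theorem fcc_norm_sq_eq (k i j : ℤ) :
    ‖barlowPos a h constHagg k i j‖ ^ 2 =
      a ^ 2 * ((i : ℝ) ^ 2 + (i : ℝ) * j + (j : ℝ) ^ 2 + (k : ℝ) * ((i : ℝ) + j) + (k : ℝ) ^ 2 / 3) +
        (k : ℝ) ^ 2 * h ^ 2 := by
  have h3 : Real.sqrt 3 ^ 2 = 3 := Real.sq_sqrt (by norm_num)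
  rw [← dist_zero_right, ← fcc_barlowPos_zero a h, dist_barlowPos_sq]
  simp only [haggLabel_const, Int.cast_zero, sub_zero]
  linear_combination (a ^ 2 / 4 * ((j : ℝ) + (k : ℝ) / 3) ^ 2) * h3

/-- **Norms of fcc sites**: every non-zero site `(k, i, j)` of `fccStacking a h` has squared norm
`≥ min (min a² (9h²)) (a²/3 + h²)` (attained: in-layer neighbours `a²`, adjacent-layer neighbours `a²/3 + h²`,
the site three layers up `9h²`).  No hypothesis on `a, h`. [folklore] -/
theorem fcc_min_le_norm_sq (k i j : ℤ) (hne : (k, i, j) ≠ (0, 0, 0)) :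
    min (min (a ^ 2) (9 * h ^ 2)) (a ^ 2 / 3 + h ^ 2) ≤ ‖barlowPos a h constHagg k i j‖ ^ 2 := by
  rw [fcc_norm_sq_eq]
  by_cases hk : (3 : ℤ) ∣ k
  · obtain ⟨m, rfl⟩ := hk
    push_cast
    by_cases hpq : (i + m, j + m) = (0, 0)
    · simp only [Prod.mk.injEq] at hpq
      obtain ⟨hi, hj⟩ := hpq
      have hm : m ≠ 0 := by
        rintro rfl
        simp only [add_zero] at hi hj
        exact hne (by simp [hi, hj])
      have hi' : (i : ℝ) = -m := by exact_mod_cast (by omega : i = -m)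
      have hj' : (j : ℝ) = -m := by exact_mod_cast (by omega : j = -m)
      have hm1 : (1 : ℝ) ≤ (m : ℝ) ^ 2 := by
        have h1 : (1 : ℤ) ≤ m ^ 2 := by nlinarith [Int.one_le_abs hm, sq_abs m]
        exact_mod_cast h1
      rw [hi', hj']
      calc min (min (a ^ 2) (9 * h ^ 2)) (a ^ 2 / 3 + h ^ 2) ≤ 9 * h ^ 2 :=
            (min_le_left _ _).trans (min_le_right _ _)
        _ ≤ _ := by nlinarith [mul_nonneg (sub_nonneg.2 hm1) (sq_nonneg h), sq_nonneg a]
    · have hform : (1 : ℝ) ≤ ((i : ℝ) + m) ^ 2 + ((i : ℝ) + m) * (j + m) + ((j : ℝ) + m) ^ 2 := by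
        exact_mod_cast one_le_sq_add_mul_add_sq (p := i + m) (q := j + m) hpq
      calc min (min (a ^ 2) (9 * h ^ 2)) (a ^ 2 / 3 + h ^ 2) ≤ a ^ 2 :=
            (min_le_left _ _).trans (min_le_left _ _)
        _ ≤ _ := by
            nlinarith [mul_nonneg (sq_nonneg a) (sub_nonneg.2 hform),
              mul_nonneg (sq_nonneg (m : ℝ)) (sq_nonneg h), sq_nonneg a, sq_nonneg h]
  · have hF1 : (1 : ℤ) ≤ 3 * (i ^ 2 + i * j + j ^ 2 + k * (i + j)) + k ^ 2 := by
      have h0 : (0 : ℤ) ≤ 3 * (i ^ 2 + i * j + j ^ 2 + k * (i + j)) + k ^ 2 := by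
        nlinarith [sq_nonneg (2 * i + j + k), sq_nonneg (3 * j + k)]
      have hne0 : 3 * (i ^ 2 + i * j + j ^ 2 + k * (i + j)) + k ^ 2 ≠ 0 := by
        intro h0'
        have h3 : (3 : ℤ) ∣ k ^ 2 := ⟨-(i ^ 2 + i * j + j ^ 2 + k * (i + j)), by linarith⟩
        exact hk (Int.prime_three.dvd_of_dvd_pow h3)
      omega
    have hF : (1 : ℝ) ≤
        3 * ((i : ℝ) ^ 2 + (i : ℝ) * j + (j : ℝ) ^ 2 + (k : ℝ) * ((i : ℝ) + j)) + (k : ℝ) ^ 2 := by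
      exact_mod_cast hF1
    have hk1 : (1 : ℝ) ≤ (k : ℝ) ^ 2 := by
      have hk0 : k ≠ 0 := by rintro rfl; exact hk (dvd_zero 3)
      have h1 : (1 : ℤ) ≤ k ^ 2 := by nlinarith [Int.one_le_abs hk0, sq_abs k]
      exact_mod_cast h1
    calc min (min (a ^ 2) (9 * h ^ 2)) (a ^ 2 / 3 + h ^ 2) ≤ a ^ 2 / 3 + h ^ 2 := min_le_right _ _
      _ ≤ _ := by
          nlinarith [mul_nonneg (sq_nonneg a) (sub_nonneg.2 hF), mul_nonneg (sub_nonneg.2 hk1) (sq_nonneg h),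
            sq_nonneg a, sq_nonneg h]

/-- **fcc is site-homogeneous** (the hypothesis `hhom` of `halfRule_feasibleOn_periodic`). -/
theorem latticeSiteSum_hom_of_fcc (ha : a ≠ 0) (hh : h ≠ 0) :
    ∀ y ∈ (fccPeriodicConfiguration ha hh).motif, ∀ y' ∈ (fccPeriodicConfiguration ha hh).motif,
      latticeSiteSum (fccPeriodicConfiguration ha hh) y =
        latticeSiteSum (fccPeriodicConfiguration ha hh) y' :=
  latticeSiteSum_hom_of_homogeneous _ (fcc_homogeneous ha hh)

/-- **fcc is attractive** when its three nearest squared distances `a²`, `9h²`, `a²/3 + h²` have cubes `≥ 1/2`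
(all realised distances `≥ 2^{-1/6}`). -/
theorem attractive_fcc (ha : a ≠ 0) (hh : h ≠ 0) (h1 : 1 / 2 ≤ (a ^ 2) ^ 3)
    (h2 : 1 / 2 ≤ (9 * h ^ 2) ^ 3) (h3 : 1 / 2 ≤ (a ^ 2 / 3 + h ^ 2) ^ 3) :
    ∀ z ∈ (fccPeriodicConfiguration ha hh).points, ∀ z' ∈ (fccPeriodicConfiguration ha hh).points,
      z ≠ z' → lennardJones (dist z z') ≤ 0 := by
  refine attractive_of_homogeneous _ (fcc_homogeneous ha hh) fun q hq hq0 => ?_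
  rw [fccPeriodicConfiguration_points] at hq
  obtain ⟨k, i, j, rfl⟩ := hq
  have hne : (k, i, j) ≠ (0, 0, 0) := by
    intro h0
    simp only [Prod.mk.injEq] at h0
    obtain ⟨rfl, rfl, rfl⟩ := h0
    exact hq0 (fcc_barlowPos_zero a h)
  have hm := fcc_min_le_norm_sq (a := a) (h := h) k i j hne
  have hm3 : 1 / 2 ≤ (min (min (a ^ 2) (9 * h ^ 2)) (a ^ 2 / 3 + h ^ 2)) ^ 3 := by
    rcases min_cases (min (a ^ 2) (9 * h ^ 2)) (a ^ 2 / 3 + h ^ 2) with ⟨e, -⟩ | ⟨e, -⟩ <;> rw [e]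
    · rcases min_cases (a ^ 2) (9 * h ^ 2) with ⟨e', -⟩ | ⟨e', -⟩ <;> rw [e']
      · exact h1
      · exact h2
    · exact h3
  have hm0 : 0 ≤ min (min (a ^ 2) (9 * h ^ 2)) (a ^ 2 / 3 + h ^ 2) :=
    le_min (le_min (sq_nonneg a) (by positivity)) (by positivity)
  exact lennardJones_nonpos_of_half_le_sq_cube (hm3.trans (pow_le_pow_left₀ hm0 hm 3))

/-- **fcc fragments never refute (half rule).**  For `(a²)³, (9h²)³, (a²/3 + h²)³ ≥ 1/2` the half rule is feasible —
`e_∞ ≤ siteE R (1/2) x i` — at every site of every finite injective fragment `x ⊆ fccStacking a h`, at every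
radius `R`. -/
theorem halfRule_feasibleOn_fcc (ha : a ≠ 0) (hh : h ≠ 0) (h1 : 1 / 2 ≤ (a ^ 2) ^ 3)
    (h2 : 1 / 2 ≤ (9 * h ^ 2) ^ 3) (h3 : 1 / 2 ≤ (a ^ 2 / 3 + h ^ 2) ^ 3) (R : ℝ) {N : ℕ}
    {x : Fin N → EuclideanSpace ℝ (Fin 3)} (hx : Function.Injective x)
    (hxP : ∀ i, x i ∈ fccStacking a h) (i : Fin N) : eInf ≤ siteE R halfRule x i :=
  halfRule_feasibleOn_periodic (fccPeriodicConfiguration ha hh) (latticeSiteSum_hom_of_fcc ha hh)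
    (attractive_fcc ha hh h1 h2 h3) R hx (fun l => by rw [fccPeriodicConfiguration_points]; exact hxP l) i

/-- **Ideal fcc fragments never refute**: for the ideal stacking `h² = 2a²/3` (all twelve neighbours at distance `a`)
the only condition is `a⁶ ≥ 1/2`, i.e. `a ≥ 2^{-1/6}`. -/
theorem halfRule_feasibleOn_fcc_ideal (ha : 0 < a) (hid : h ^ 2 = 2 * a ^ 2 / 3) (h1 : 1 / 2 ≤ a ^ 6)
    (R : ℝ) {N : ℕ} {x : Fin N → EuclideanSpace ℝ (Fin 3)} (hx : Function.Injective x)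
    (hxP : ∀ i, x i ∈ fccStacking a h) (i : Fin N) : eInf ≤ siteE R halfRule x i := by
  have hh : h ≠ 0 := by
    rintro rfl
    have : a ^ 2 = 0 := by nlinarith
    exact ha.ne' (pow_eq_zero_iff two_ne_zero |>.1 this)
  have e1 : (a ^ 2) ^ 3 = a ^ 6 := by ring
  have e2 : (9 * h ^ 2) ^ 3 = 216 * a ^ 6 := by rw [hid]; ring
  have e3 : (a ^ 2 / 3 + h ^ 2) ^ 3 = a ^ 6 := by rw [hid]; ring
  exact halfRule_feasibleOn_fcc ha.ne' hh (by rw [e1]; exact h1) (by rw [e2]; nlinarith [h1])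
    (by rw [e3]; exact h1) R hx hxP i

/-- **Close-packed fragments never refute, by name.**  A finite zoo each of whose members is an injective fragment
of an ideal hcp stacking or of an ideal fcc stacking (`h = a √(2/3)`, spacing `a` with `a⁶ ≥ 1/2`, possibly a
different `a` per member) is not refuting at any look radius `R`: the half rule is feasible on all of it.  This is
the Barlow-ball part of the lane's R = 2 union zoo (hcp/fcc balls at `a* = 0.9712`). -/
theorem not_refuting_of_closePacked_fragments (R : ℝ)
    (Z : Finset (Σ N : ℕ, Fin N → EuclideanSpace ℝ (Fin 3)))
    (hZ : ∀ c ∈ Z, Function.Injective c.2 ∧ ∃ a : ℝ, 0 < a ∧ 1 / 2 ≤ a ^ 6 ∧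
      ((∀ i, c.2 i ∈ hcpStacking a (a * Real.sqrt (2 / 3))) ∨
        ∀ i, c.2 i ∈ fccStacking a (a * Real.sqrt (2 / 3)))) :
    ¬ ∀ Φ : EuclideanSpace ℝ (Fin 3) → Finset (EuclideanSpace ℝ (Fin 3)) → ℝ, IsRule Φ →
      ∃ c ∈ Z, ∃ i : Fin c.1, siteE R Φ c.2 i < eInf := by
  intro href
  obtain ⟨c, hc, i, hlt⟩ := href halfRule isRule_halfRule
  obtain ⟨hinj, a, ha, h6, hmem⟩ := hZ c hc
  have hid : (a * Real.sqrt (2 / 3)) ^ 2 = 2 * a ^ 2 / 3 := by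
    rw [mul_pow, Real.sq_sqrt (by norm_num)]; ring
  rcases hmem with hmem | hmem
  · exact (not_lt.2 (halfRule_feasibleOn_hcp_ideal ha hid h6 R hinj hmem i)) hlt
  · exact (not_lt.2 (halfRule_feasibleOn_fcc_ideal ha hid h6 R hinj hmem i)) hlt

end Fcc

end Summit.AtomisticToContinuum.Crystallization.Theorems.StrictSplittingRuleBirth
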